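import Summits.BirchSwinnertonDyer.BirchSwinnertonDyer.Theorems.GoldfeldK12AdditiveTwoConjectureD
import Summits.BirchSwinnertonDyer.BirchSwinnertonDyer.Theorems.GoldfeldAllTwistsTwoConverseTwinAdditiveTwoSplitThreeTwistDescent
import Summits.BirchSwinnertonDyer.BirchSwinnertonDyer.Theorems.GoldfeldAllTwistsTwoConverseTwinAdditiveTwoSplitSevenTwistDescent
import HarnessLib

set_option linter.dupNamespace false -- namespace `…BirchSwinnertonDyer.BirchSwinnertonDyer…` is the cell's (D-0017 nested layout)
set_option autoImplicit false

/-!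
# Crux K12₂″ (item 20044): the `7`-INERT half — `X₀(49)` over the imaginary quadratic `K` with `4 ∣ d_K`
# and `7` INERT in `K` (no Heegner point of level `49`), as its own named leaf; the crux BY NAME from the
# Heegner sub-leaf (`7` split) and this leaf (`7` inert) ALONE — the `7`-ramified fields are not needed

Cell `bsd-goldfeld`, prover seat `bsd-goldfeld-s1p-c201` (gen 7), `--supports stmt-BirchSwinnertonDyer-20044`
(route decl `Summit.BirchSwinnertonDyer.BirchSwinnertonDyer.Theses.GoldfeldAllTwistsTwoConverse.RankOneTwoConverseCMSevenAdditiveTwo`,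
K12₂″: for every globally minimal elliptic `W/ℚ` with `j(W) = −3375`, NOT good at `2`,
`corank_{ℤ₂} Sel_{2^∞}(W/ℚ) = 1 ⟹ ord_{s=1} L(W, s) = 1`). The item is OPEN mathematics; NOTHING HERE PROVES IT.
Companion memo: `run/shared/lean/pub/bsd-goldfeld/K12PP-INERT7.md`.

## What this file adds

File 1 (`GoldfeldK12AdditiveTwoBaseChange`, p418192) proved K12₂″ ⟺ `X049KLevelTwoConverseEvenDiscr` (the
rank-one `2^∞`-Selmer converse for `E₀ = X₀(49) = cm7` over every imaginary quadratic `K` with `4 ∣ d_K`), and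
file `GoldfeldK12AdditiveTwoRamifiedHeegner` (p443153) cut that leaf at the prime `7`: the HEEGNER half (`7` split:
sub-leaf `X049HeegnerNonTorsionEvenDiscr`, on which every infinite-family theorem of the cell lives — B49,
Kriz–Li at `7`, genus descent, half-trace) and «the rest» (`hRest`: `7` inert OR ramified, an inline binder).
Here:

* §1 `X049KLevelTwoConverseInertSeven` — the `7`-INERT half as a closed, NAMED `Prop` (nothing asserted):
  `K` imaginary quadratic, `4 ∣ d_K`, `(d_K / 7) = −1`, `corank_{ℤ₂} Sel_{2^∞}(X₀(49)/K) = 1 ⟹ ord_{s=1} L(X₀(49)/K, s) = 1`.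
  By c301's sign law (`…K12AdditiveTwoSign`: K12₂″ lives on the NEGATIVE twists `49a1^{(d)}`, `d < 0`, `7 ∤ d`,
  the twists with `7 ∣ d` being reached through the isogeny `E₀^{(7e)} ∼ E₀^{(−e)}`) the `7`-RAMIFIED fields are
  never needed: §3 assembles the crux BY NAME from the Heegner sub-leaf and §1 alone.
* §2 the crux on the inert half from the leaf: every elliptic `W ≅_ℚ E₀^{(n)}`, `n < 0` squarefree,
  `n ≢ 1 (mod 4)`, `(n/7) = −1` (`7` inert in `ℚ(√n)`): corank `1 ⟹ r_an = 1`
  (`analyticRank_eq_one_of_inertSeven`; Artin formalism over `K = ℚ(√n)`, `d_K = 4n`, exactly as file 1).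
* §3 `rankOneTwoConverseCMSevenAdditiveTwo_of_heegnerNonTorsion_of_inertSeven` — THE CRUX (route decl, by name)
  from the two named halves at `7`, granted Modularity, `2`-parity, Coates–Li–Tian–Zhai Thm. 1.2 at `R = 1`,
  Gross–Zagier and Heegner rationality (the split half only).
* §4 honesty: the crux implies the inert leaf (`inertSeven_of_rankOneTwoConverseCMSevenAdditiveTwo`), so §1 is a
  NECESSARY content of any proof of item 20044; and the partition theorem
  `rankOneTwoConverseCMSevenAdditiveTwo_iff_heegnerNonTorsion_and_inertSeven`.
* §5 the two inert PRIME-twist families, the complement of the cell's B49 families at `7`: `q` prime SPLIT in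
  `ℚ(√−7)` (`(q/7) = +1`), twists `49a1^{(−q)}` (`q ≡ 1 (mod 4)`) and `49a1^{(−2q)}`: the leaf ⟹ K12₂″'s
  implication on every model (`analyticRank_eq_one_splitPrimeTwist_of_inertSeven`, `…_twoSplitPrimeTwist_…`); and
  on the sub-families `ℓ ≡ 5 (mod 8)`, where seat c301 gen 2 CERTIFIED `corank_{ℤ₂} Sel_{2^∞} = 1`
  (`selmerCorank_two_eq_one_splitPrimeTwist`), the leaf ⟹ «Conjecture D_split(ℓ)»
  `ord_{s=1} L(49a1^{(−ℓ)}, s) = 1` OUTRIGHT (`…_fiveModEight_of_inertSeven`), and likewise for `49a1^{(−2ℓ)}`,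
  `ℓ ≢ 1 (mod 8)` split (c301 gen 2–3 parts IX/XVIII/XX; `…_neOneModEight_of_inertSeven`) — the
  `7`-inert twin of «D(q)» — and K12₂″ itself asserts «D_split(ℓ)» there (`…_of_rankOneTwoConverseCMSevenAdditiveTwo`).

What the inert half IS, mathematically (memo K12PP-INERT7.md; nothing of it is typed here): for `(d_K, 7) = 1` the
sign of `L(X₀(49)/K, s)` is `−1` whatever the splitting of `7` (`w(E₀) w(E₀^{(d_K)}) = (+1)(−1)`), and for `7`
inert the Tunnell–Saito set is `Σ = {∞}` (odd cardinality, `7 ∉ Σ` because `π₇(f₄₉) ⊗ η₇ ≅ π₇(f₄₉)` for the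
unramified quadratic `η₇` — the dihedral supercuspidal induced from the ramified `ℚ₇(√−7)`), so the
Yuan–Zhang–Zhang Shimura curve is a MODULAR curve: the CM points by `𝒪_K` live on the non-split Cartan curve
`X_ns(7)` (`Jac X_ns(7) ∼ J₀(49)^{new} = 49a`, Chen 1998 / Edixhoven; Kohen–Pacetti, Canad. J. Math. 68 (2016)
Def. 4.2, Prop. 4.4–4.6, Thm. 4.7 (Kolyvagin), Thm. 4.8 (Gross–Zagier–Zhang), Table 1 row `49a`, `K = ℚ(√−11)`,
optimal quotient `49a2`). The analogue of the sub-leaf on this half — «corank `1` forces the Cartan–Heegner point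
off the torsion» — needs that object in the tree (none today: `ModularParametrizationData` is `Γ₀(N)`-only); the
leaf of §1 is its `L`-function shadow.

Published inputs, as the cell's standing cite-tagged binders: Modularity `hnf : ModularForms.exists_isNewformOf`,
`2`-parity `hpar : p_parity · 2` (Dokchitser–Dokchitser), Coates–Li–Tian–Zhai Thm. 1.2 at `R = 1` (`h12`),
Gross–Zagier (`hGZ`), `K`-rationality of Heegner points (`hHP`). No `sorry`, no axiom, no instance, no notation.

References: D. Kohen, A. Pacetti, Canad. J. Math. 68 (2016) 422–444 [discussed in the docstrings and the memo
only; NOT a binder of any theorem here]; B. Gross, D. Zagier, Invent. Math. 84 (1986) Thm. I.6.3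
[GrossZagier1986]; J. Coates, Y. Li, Y. Tian, S. Zhai, PLMS 110 (2015) Thm. 1.2 [CoatesLiTianZhai2015];
A. Burungale, F. Castella, C. Skinner, Y. Tian, Ann. Math. Qué. 46 (2022) Rem. D [BurungaleCastellaSkinnerTian2022];
T. Dokchitser, V. Dokchitser, Ann. of Math. 172 (2010) Thm. 1.4 [DokchitserDokchitser2010].
-/

noncomputable section

open scoped Classical

open WeierstrassCurve Literature.NumberTheory Literature.NumberTheory.EllipticCurves
  Literature.NumberTheory.EllipticCurves.ModularForms

namespace Summit.BirchSwinnertonDyer.BirchSwinnertonDyer.Theorems.GoldfeldGoodTwists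

/-! ## §1 The `7`-inert half of `X049KLevelTwoConverseEvenDiscr` as a named leaf -/

/-- **LEAF `X049KLevelTwoConverseInertSeven` (OPEN; nothing asserted) — the `7`-INERT half of the crux K12₂″.**
For every imaginary quadratic field `K` with `4 ∣ d_K` (`2` ramified) and `(d_K / 7) = −1` (`7` INERT in `K`;
no Heegner point of level `49` on `X₀(49)`, the classical Heegner hypothesis failing at `7`):
`corank_{ℤ₂} Sel_{2^∞}(X₀(49)/K) = 1 ⟹ ord_{s=1} L(X₀(49)/K, s) = 1`. Equivalently (§2/§4): K12₂″ for the twists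
`49a1^{(n)}`, `n < 0` squarefree, `n ≢ 1 (mod 4)`, `(n/7) = −1`. The sign of `L(X₀(49)/K, s)` is `−1` and the
relevant Gross–Zagier–Zhang setting is the non-split Cartan modular curve of level `7` (Kohen–Pacetti 2016, Table 1
row `49a`); the converse at the additive prime `2` is not in print on either half.
[cite: BurungaleCastellaSkinnerTian2022, Rem. D (p. 327) (the excluded additive case; shape only, nothing asserted)] -/
@[conjecture] def X049KLevelTwoConverseInertSeven : Prop :=
  ∀ (K : Type) [Field K] [NumberField K], IsImaginaryQuadratic K → (4 : ℤ) ∣ NumberField.discr K →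
    jacobiSym (NumberField.discr K) 7 = -1 → (cm7.baseChange K).selmerCorank 2 = 1 → analyticRankEK cm7 K = 1

/-- The inert leaf is a restriction of file 1's leaf `X049KLevelTwoConverseEvenDiscr`. [folklore] -/
theorem inertSeven_of_kLevelEvenDiscr (hX : X049KLevelTwoConverseEvenDiscr) : X049KLevelTwoConverseInertSeven :=
  fun K _ _ hK h4 _ hsel ↦ hX K hK h4 hsel

/-! ## §2 The crux on the `7`-inert half of the additive cell, from the leaf -/

/-- **THE CRUX ON THE INERT HALF, from the leaf.** Assume analytic continuation (`hmod`), Coates–Li–Tian–Zhai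
Thm. 1.2 at `R = 1` (`h12`) and the leaf `X049KLevelTwoConverseInertSeven` (`hI`). Let `W/ℚ` be elliptic,
`ℚ`-isomorphic to `E₀^{(n)}` (`C • W = cm7^{(n)}`) with `n < 0` squarefree, `n ≢ 1 (mod 4)` and `(n/7) = −1`
(`7` inert in `ℚ(√n)`). Then `corank_{ℤ₂} Sel_{2^∞}(W/ℚ) = 1 ⟹ ord_{s=1} L(W, s) = 1`. Proof: `K = ℚ(√n)`,
`d_K = 4n`, `(d_K/7) = (n/7) = −1`; `corank(E₀/K) = 0 + corank(E₀^{(4n)}) = corank(W) = 1`; the leaf and Artin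
formalism give `ord L(E₀/K) = 0 + ord L(W) = 1` — no Heegner point is used.
[cite: CoatesLiTianZhai2015, Thm. 1.2 (p. 359, case r = 0)] [cite: GrossZagier1986, I.§7 (Artin formalism)] -/
theorem analyticRank_eq_one_of_inertSeven (hmod : hasEntireLFunction_rat)
    (h12 : CoatesLiTianZhai2015.thm12_fullBSD_twist) (hI : X049KLevelTwoConverseInertSeven)
    (W : WeierstrassCurve ℚ) [W.IsElliptic] {n : ℤ} (hsq : Squarefree n) (hneg : n < 0) (hn4 : n % 4 ≠ 1)
    (hn7 : jacobiSym n 7 = -1) {C : VariableChange ℚ} (hC : C • W = cm7.quadraticTwist (n : ℚ))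
    (hsel : W.selmerCorank 2 = 1) : W.analyticRank = 1 := by
  have hn0 : n ≠ 0 := hsq.ne_zero
  have hnQ : (n : ℚ) ≠ 0 := Int.cast_ne_zero.mpr hn0
  haveI := cm7.isElliptic_quadraticTwist hnQ
  -- `n ≡ 2, 3 (mod 4)`
  have hnsq4 : ¬ (4 : ℤ) ∣ n := fun h4' ↦ by
    have h22 : (2 : ℤ) * 2 ∣ n := by rwa [show (2 : ℤ) * 2 = 4 by norm_num]
    have hu := Int.isUnit_iff.mp (hsq 2 h22)
    omega
  have hres : n % 4 = 2 ∨ n % 4 = 3 := by omega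
  -- `K = ℚ(√n)`, `d_K = 4n`, imaginary, `7` inert
  obtain ⟨K, _, _, h2, hdK⟩ := QuadraticFields.Quadratic.exists_numberField_discr_eq (D := 4 * n)
    (Or.inr ⟨dvd_mul_right 4 n, by rw [show 4 * n / 4 = n by omega]; exact hres,
      by rw [show 4 * n / 4 = n by omega]; exact hsq⟩)
  have hK : IsImaginaryQuadratic K :=
    isImaginaryQuadratic_iff_discr_neg.mpr ⟨h2, by rw [hdK]; omega⟩
  have h4K : (4 : ℤ) ∣ NumberField.discr K := hdK ▸ dvd_mul_right 4 n
  have h7K : jacobiSym (NumberField.discr K) 7 = -1 := by rw [hdK, jacobiSym_four_mul_seven, hn7]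
  -- `E₀^{(d_K)} = E₀^{(4n)} ≅ E₀^{(n)} ≅ W`
  have htw : cm7.quadraticTwist (NumberField.discr K : ℚ) =
      (⟨(Units.mk0 (2 : ℚ) two_ne_zero)⁻¹, 0, 0, 0⟩ : VariableChange ℚ) • cm7.quadraticTwist (n : ℚ) := by
    rw [hdK]; exact quadraticTwist_cm7_four_mul n
  haveI : (cm7.quadraticTwist (NumberField.discr K : ℚ)).IsElliptic := by rw [htw]; infer_instance
  have hWdK : IsIsogenous W (cm7.quadraticTwist (NumberField.discr K : ℚ)) := by
    rw [htw]
    exact (isIsogenous_of_smul_eq hC).trans' (isIsogenous_smul _ _)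
  -- corank over `K` is `0 + 1`
  have hselK : (cm7.baseChange K).selmerCorank 2 = 1 := by
    rw [selmerCorank_cm7_baseChange h12 K h2, ← hWdK.selmerCorank_eq 2, hsel]
  -- the leaf on the inert half, then Artin formalism
  have hEK := hI K hK h4K h7K hselK
  rw [analyticRankEK_cm7 hmod h12 K, ← analyticRank_eq_of_isIsogenous' hWdK] at hEK
  exact hEK

/-! ## §3 The whole crux from the two NAMED halves at `7` (Heegner sub-leaf + inert leaf) -/

/-- `(n / 7) ∈ {1, −1}` for `7 ∤ n` (quadratic character modulo the prime `7`). [folklore] -/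
theorem jacobiSym_seven_eq_one_or_eq_neg_one {n : ℤ} (h7 : ¬ (7 : ℤ) ∣ n) :
    jacobiSym n 7 = 1 ∨ jacobiSym n 7 = -1 := by
  have hg : Int.gcd n 7 = 1 := by
    have h7' : (Int.gcd n 7 : ℕ) ∣ 7 := by exact_mod_cast (Int.gcd_dvd_right n 7)
    rcases (Nat.dvd_prime (by norm_num : Nat.Prime 7)).mp h7' with h | h
    · exact h
    · exfalso; apply h7
      have hn : ((Int.gcd n 7 : ℕ) : ℤ) ∣ n := Int.gcd_dvd_left n 7
      rwa [h] at hn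
  have hne : jacobiSym n 7 ≠ 0 := by
    rw [Ne, jacobiSym.eq_zero_iff]
    rintro ⟨-, hg'⟩
    exact hg' hg
  rcases jacobiSym.trichotomy n 7 with h | h | h
  · exact absurd h hne
  · exact Or.inl h
  · exact Or.inr h

/-- **CRUX K12₂″ (route decl, by name) from the Heegner sub-leaf and the `7`-inert leaf**, granted Modularity
(`hnf`), `2`-parity (`hpar`, Dokchitser–Dokchitser), Coates–Li–Tian–Zhai Thm. 1.2 at `R = 1` (`h12`),
Gross–Zagier (`hGZ`) and the `K`-rationality of Heegner points (`hHP`) — the last two on the split half only.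
By c301's sign law (`rankOneTwoConverseCMSevenAdditiveTwo_of_negTwists`: corank `1` forces root number `−1`, so
the cell is the NEGATIVE twists `49a1^{(d)}`, `d < 0`, `7 ∤ d`, the `7 ∣ d` ones through `E₀^{(7e)} ∼ E₀^{(−e)}`),
every such `d` has `(d/7) = +1` (Heegner half: `analyticRank_eq_one_of_heegnerNonTorsionEvenDiscr_of_not_good`) or
`(d/7) = −1` (inert half: §2). The `7`-RAMIFIED imaginary quadratic fields of file `…RamifiedHeegner`'s binder
`hRest` are thereby dispensed with. [cite: CoatesLiTianZhai2015, Thm. 1.2 (p. 359, case r = 0)]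
[cite: DokchitserDokchitser2010, Thm. 1.4] [cite: GrossZagier1986, Thm. I.(6.3) and I.§7] -/
theorem rankOneTwoConverseCMSevenAdditiveTwo_of_heegnerNonTorsion_of_inertSeven
    (hnf : ModularForms.exists_isNewformOf) (h12 : CoatesLiTianZhai2015.thm12_fullBSD_twist)
    (hpar : ∀ (V : WeierstrassCurve ℚ) [V.IsElliptic], p_parity V 2)
    (hGZ : ∀ (N : ℕ) [NeZero N] (W : WeierstrassCurve ℚ) (K : Type) [Field K] [NumberField K],
      gross_zagier N W K)
    (hHP : ∀ (W : WeierstrassCurve ℚ) (K : Type) [Field K] [NumberField K], exists_isHeegnerPoint W K)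
    (hNT : X049HeegnerNonTorsionEvenDiscr) (hI : X049KLevelTwoConverseInertSeven) :
    Summit.BirchSwinnertonDyer.BirchSwinnertonDyer.Theses.GoldfeldAllTwistsTwoConverse.RankOneTwoConverseCMSevenAdditiveTwo := by
  refine rankOneTwoConverseCMSevenAdditiveTwo_of_negTwists hnf h12 hpar ?_
  intro d hd hsq h7 hd4 W' _ _ C hC hsel
  rcases jacobiSym_seven_eq_one_or_eq_neg_one h7 with h1 | h1
  · exact analyticRank_eq_one_of_heegnerNonTorsionEvenDiscr hnf h12 hGZ hHP hNT W' hsq hd hd4 h1 hC hsel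
  · exact analyticRank_eq_one_of_inertSeven (hasEntireLFunction_rat_of_exists_isNewformOf hnf) h12 hI W'
      hsq hd hd4 h1 hC hsel

/-! ## §4 Honesty: the crux implies the inert leaf; the partition at `7` is exact -/

/-- **HONESTY CLAUSE: the crux K12₂″ (route decl, by name) implies the `7`-inert leaf**, granted analytic
continuation and Coates–Li–Tian–Zhai Thm. 1.2 at `R = 1` (file 1's `kLevelEvenDiscr_of_rankOneTwoConverseCMSevenAdditiveTwo`,
then restriction): any proof of item 20044 proves the rank-one `2`-converse for `X₀(49)` over the `2`-ramified,
`7`-inert imaginary quadratic fields. [cite: CoatesLiTianZhai2015, Thm. 1.2 (p. 359, case r = 0)] -/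
theorem inertSeven_of_rankOneTwoConverseCMSevenAdditiveTwo (hmod : hasEntireLFunction_rat)
    (h12 : CoatesLiTianZhai2015.thm12_fullBSD_twist)
    (hXL : Summit.BirchSwinnertonDyer.BirchSwinnertonDyer.Theses.GoldfeldAllTwistsTwoConverse.RankOneTwoConverseCMSevenAdditiveTwo) :
    X049KLevelTwoConverseInertSeven :=
  inertSeven_of_kLevelEvenDiscr (kLevelEvenDiscr_of_rankOneTwoConverseCMSevenAdditiveTwo hmod h12 hXL)

/-- **The partition of K12₂″ at the prime `7` is exact**: granted Modularity, `2`-parity, Coates–Li–Tian–Zhai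
Thm. 1.2 at `R = 1`, Gross–Zagier and Heegner rationality, the crux is EQUIVALENT to the conjunction of the
Heegner sub-leaf `X049HeegnerNonTorsionEvenDiscr` (`7` split) and the inert leaf `X049KLevelTwoConverseInertSeven`
(`7` inert). [cite: GrossZagier1986, Thm. I.(6.3) and I.§7] [cite: CoatesLiTianZhai2015, Thm. 1.2 (p. 359, case r = 0)] -/
theorem rankOneTwoConverseCMSevenAdditiveTwo_iff_heegnerNonTorsion_and_inertSeven
    (hnf : ModularForms.exists_isNewformOf) (h12 : CoatesLiTianZhai2015.thm12_fullBSD_twist)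
    (hpar : ∀ (V : WeierstrassCurve ℚ) [V.IsElliptic], p_parity V 2)
    (hGZ : ∀ (N : ℕ) [NeZero N] (W : WeierstrassCurve ℚ) (K : Type) [Field K] [NumberField K],
      gross_zagier N W K)
    (hHP : ∀ (W : WeierstrassCurve ℚ) (K : Type) [Field K] [NumberField K], exists_isHeegnerPoint W K) :
    Summit.BirchSwinnertonDyer.BirchSwinnertonDyer.Theses.GoldfeldAllTwistsTwoConverse.RankOneTwoConverseCMSevenAdditiveTwo ↔
      (X049HeegnerNonTorsionEvenDiscr ∧ X049KLevelTwoConverseInertSeven) :=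
  ⟨fun h ↦ ⟨heegnerNonTorsionEvenDiscr_of_rankOneTwoConverseCMSevenAdditiveTwo hnf h12 hGZ h,
      inertSeven_of_rankOneTwoConverseCMSevenAdditiveTwo (hasEntireLFunction_rat_of_exists_isNewformOf hnf) h12 h⟩,
    fun h ↦ rankOneTwoConverseCMSevenAdditiveTwo_of_heegnerNonTorsion_of_inertSeven hnf h12 hpar hGZ hHP h.1 h.2⟩

/-! ## §5 The inert PRIME-twist families: primes SPLIT in `ℚ(√−7)`; «Conjecture D_split(ℓ)» -/

/-- `(−q / 7) = −1` for `(q/7) = +1` (`(−1/7) = −1` as `7 ≡ 3 (mod 4)`): for a prime `q` SPLIT in `ℚ(√−7)`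
the field `ℚ(√−q)` has `7` INERT — the complement, at `7`, of the cell's B49 family `(q/7) = −1`. [folklore] -/
theorem jacobiSym_neg_seven_of_jacobiSym_eq_one {q : ℤ} (hq7 : jacobiSym q 7 = 1) : jacobiSym (-q) 7 = -1 := by
  have h1 : jacobiSym (-1) 7 = -1 := by
    rw [jacobiSym.at_neg_one (by decide), ZMod.χ₄_nat_three_mod_four (by norm_num)]
  rw [neg_eq_neg_one_mul, jacobiSym.mul_left, h1, hq7]
  norm_num

/-- `(−2q / 7) = −1` for `(q/7) = +1` (`(2/7) = +1` as `7 ≡ 7 (mod 8)`, `(−1/7) = −1`): for a prime `q` split in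
`ℚ(√−7)` the field `ℚ(√−2q)` has `7` INERT. [folklore] -/
theorem jacobiSym_neg_two_mul_seven_of_jacobiSym_eq_one {q : ℤ} (hq7 : jacobiSym q 7 = 1) :
    jacobiSym (-(2 * q)) 7 = -1 := by
  have h2 : jacobiSym 2 7 = 1 := by norm_num
  rw [show (-(2 * q) : ℤ) = 2 * (-q) by ring, jacobiSym.mul_left, h2, one_mul]
  exact jacobiSym_neg_seven_of_jacobiSym_eq_one hq7

/-- **K12₂″ on the inert PRIME-twist family `49a1^{(−q)}`, `q ≡ 1 (mod 4)` prime SPLIT in `ℚ(√−7)`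
(`(q/7) = +1`), from the inert leaf.** For every elliptic `W/ℚ` that is `ℚ`-isomorphic to `E₀^{(−q)}` (additive at
`2`; conductor `784 q²`): `corank_{ℤ₂} Sel_{2^∞}(W/ℚ) = 1 ⟹ ord_{s=1} L(W, s) = 1`, granted analytic continuation,
Coates–Li–Tian–Zhai 1.2 at `R = 1` and `X049KLevelTwoConverseInertSeven` — through `X₀(49)` over `ℚ(√−q)`
(`d_K = −4q`, `7` inert): the complement at `7` of c301's B49 family; NO Heegner point of level `49` exists here
(the Gross–Zagier–Zhang object is a CM point of the non-split Cartan curve `X_ns(7)`, Kohen–Pacetti 2016, or a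
genus-character point of `X₀(49)` over a composite `7`-split field, memo K12PP-INERT7 §3).
[cite: CoatesLiTianZhai2015, Thm. 1.2 (p. 359, case r = 0)] -/
theorem analyticRank_eq_one_splitPrimeTwist_of_inertSeven (hmod : hasEntireLFunction_rat)
    (h12 : CoatesLiTianZhai2015.thm12_fullBSD_twist) (hI : X049KLevelTwoConverseInertSeven)
    {q : ℕ} (hq : q.Prime) (hq4 : q % 4 = 1) (hq7 : jacobiSym q 7 = 1)
    (W : WeierstrassCurve ℚ) [W.IsElliptic] (C : VariableChange ℚ)
    (hC : C • W = cm7.quadraticTwist ((-q : ℤ) : ℚ)) (hsel : W.selmerCorank 2 = 1) :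
    W.analyticRank = 1 := by
  have hsq : Squarefree (-(q : ℤ)) := by
    rw [← Int.squarefree_natAbs, Int.natAbs_neg, Int.natAbs_natCast]
    exact hq.squarefree
  exact analyticRank_eq_one_of_inertSeven hmod h12 hI W hsq (by have := hq.pos; omega) (by omega)
    (jacobiSym_neg_seven_of_jacobiSym_eq_one (by exact_mod_cast hq7)) hC hsel

/-- **K12₂″ on the inert PRIME-twist family `49a1^{(−2q)}`, `q` odd prime SPLIT in `ℚ(√−7)` (`(q/7) = +1`),
from the inert leaf.** For every elliptic `W ≅_ℚ E₀^{(−2q)}` (additive at `2`): corank `1 ⟹ r_an = 1`, granted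
analytic continuation, Coates–Li–Tian–Zhai 1.2 at `R = 1` and `X049KLevelTwoConverseInertSeven` — through `X₀(49)`
over `ℚ(√−2q)` (`d_K = −8q`, `7` inert). [cite: CoatesLiTianZhai2015, Thm. 1.2 (p. 359, case r = 0)] -/
theorem analyticRank_eq_one_twoSplitPrimeTwist_of_inertSeven (hmod : hasEntireLFunction_rat)
    (h12 : CoatesLiTianZhai2015.thm12_fullBSD_twist) (hI : X049KLevelTwoConverseInertSeven)
    {q : ℕ} (hq : q.Prime) (hq2 : q ≠ 2) (hq7 : jacobiSym q 7 = 1)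
    (W : WeierstrassCurve ℚ) [W.IsElliptic] (C : VariableChange ℚ)
    (hC : C • W = cm7.quadraticTwist ((-(2 * q) : ℤ) : ℚ)) (hsel : W.selmerCorank 2 = 1) :
    W.analyticRank = 1 := by
  have hqodd : Odd q := hq.odd_of_ne_two hq2
  have hsq : Squarefree (-(2 * (q : ℤ))) := by
    rw [← Int.squarefree_natAbs, Int.natAbs_neg, Int.natAbs_mul, Int.natAbs_natCast,
      show (2 : ℤ).natAbs = 2 from rfl]
    refine Nat.squarefree_mul_iff.mpr ⟨?_, Nat.squarefree_two, hq.squarefree⟩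
    exact (Nat.coprime_primes Nat.prime_two hq).mpr (Ne.symm hq2)
  have hq4 : (-(2 * (q : ℤ))) % 4 ≠ 1 := by
    obtain ⟨k, hk⟩ := hqodd
    omega
  exact analyticRank_eq_one_of_inertSeven hmod h12 hI W hsq (by have := hq.pos; omega) hq4
    (jacobiSym_neg_two_mul_seven_of_jacobiSym_eq_one (by exact_mod_cast hq7)) hC hsel

/-- **«Conjecture D_split(ℓ)» from the inert leaf — NO corank hypothesis.** For a prime `ℓ ≡ 5 (mod 8)` SPLIT in
`ℚ(√−7)` (`(−7/ℓ) = +1`; `ℓ = 37, 53, 109, 149, 197, …`) and EVERY elliptic `W ≅_ℚ 49a1^{(−ℓ)}`: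
`ord_{s=1} L(W, s) = 1`, granted Modularity (`hnf`), Coates–Li–Tian–Zhai 1.2 at `R = 1` (`h12`), `2`-parity
(`hpar`) and the inert leaf — because on this family `corank_{ℤ₂} Sel_{2^∞}(W) = 1` is a KERNEL THEOREM (seat
c301 gen 2, parts VIII–IX: `#S ≤ 4`, `#S' ≤ 2`, root number `−1`; `selmerCorank_two_eq_one_splitPrimeTwist`). This
is the `7`-INERT twin of the cell's «Conjecture D(q)» on the B49 family (`analyticRank_eq_one_inertPrimeTwist_of_heegnerNonTorsion`,
there from the Heegner sub-leaf); numerically `r_an = 1` for all `57` such `ℓ ≤ 3000` (c301 gen-0 tables) and for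
every member of kit j264668 (this seat). For split `ℓ ≡ 1 (mod 8)` the `2`-descent is NOT uniform (`Ш[2] ≅ (ℤ/2)²`
occurs), so only the corank-hypothesis form `analyticRank_eq_one_splitPrimeTwist_of_inertSeven` is stated there.
[cite: DokchitserDokchitserAnnals2010, Thm. 1.4] [cite: SilvermanAEC2009, Thm. X.4.2(a), Prop. X.4.9]
[cite: CoatesLiTianZhai2015, Thm. 1.2 (p. 359, case r = 0)] -/
theorem analyticRank_eq_one_splitPrimeTwist_fiveModEight_of_inertSeven (hnf : ModularForms.exists_isNewformOf)
    (h12 : CoatesLiTianZhai2015.thm12_fullBSD_twist) (hpar : ∀ (V : WeierstrassCurve ℚ) [V.IsElliptic], p_parity V 2)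
    (hI : X049KLevelTwoConverseInertSeven) {l : ℕ} [Fact l.Prime] (hl8 : l % 8 = 5) (hl7 : legendreSym l (-7) = 1)
    (W : WeierstrassCurve ℚ) [W.IsElliptic] (C : VariableChange ℚ)
    (hC : C • W = cm7.quadraticTwist ((-l : ℤ) : ℚ)) : W.analyticRank = 1 := by
  have hl : l.Prime := Fact.out
  have hj : jacobiSym l 7 = 1 := by rw [jacobiSym_seven_eq_legendreSym_neg_seven (by omega), hl7]
  exact analyticRank_eq_one_splitPrimeTwist_of_inertSeven (hasEntireLFunction_rat_of_exists_isNewformOf hnf) h12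
    hI hl (by omega) hj W C hC (selmerCorank_two_eq_one_splitPrimeTwist hnf h12 hpar hl8 hl7 W C hC)

/-- `(−7/ℓ) = +1 ⟹ (ℓ/7) = +1` for an odd prime `ℓ` (quadratic reciprocity with `−7 ≡ 1 (mod 4)`; the case
`ℓ ≡ 1 (mod 4)` is this seat's `jacobiSym_seven_eq_legendreSym_neg_seven`, the case `ℓ ≡ 3 (mod 4)` is
`(ℓ/7) = −(7/ℓ) = (−1/ℓ)(7/ℓ) = (−7/ℓ)`; cf. c301's `jacobiSym_seven_eq_legendreSym_neg_seven_odd`). [folklore] -/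
theorem jacobiSym_seven_eq_one_of_legendreSym_neg_seven {l : ℕ} [Fact l.Prime] (hl2 : l ≠ 2)
    (hl7 : legendreSym l (-7) = 1) : jacobiSym l 7 = 1 := by
  have hl : l.Prime := Fact.out
  have hodd : l % 2 = 1 := Nat.odd_iff.mp (hl.odd_of_ne_two hl2)
  rcases (show l % 4 = 1 ∨ l % 4 = 3 by omega) with h4 | h4
  · rw [jacobiSym_seven_eq_legendreSym_neg_seven h4, hl7]
  · have h1 : jacobiSym (l : ℤ) 7 = -jacobiSym 7 l := by
      exact_mod_cast jacobiSym.quadratic_reciprocity_three_mod_four h4 (by decide : 7 % 4 = 3)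
    have h2 : jacobiSym 7 l = legendreSym l 7 := (jacobiSym.legendreSym.to_jacobiSym l 7).symm
    have h3 : legendreSym l (-7) = legendreSym l (-1) * legendreSym l 7 := by
      rw [show (-7 : ℤ) = -1 * 7 by norm_num, legendreSym.mul]
    rw [legendreSym.at_neg_one hl2, ZMod.χ₄_nat_three_mod_four h4] at h3
    rw [h1, h2]
    linarith [h3, hl7]

/-- **«Conjecture D_split,2(ℓ)» from the inert leaf — NO corank hypothesis**: for an odd prime `ℓ ≢ 1 (mod 8)`
split in `ℚ(√−7)` (`(−7/ℓ) = +1`) and EVERY elliptic `W ≅_ℚ 49a1^{(−2ℓ)}`: `ord_{s=1} L(W, s) = 1`, granted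
Modularity, Coates–Li–Tian–Zhai 1.2 at `R = 1`, `2`-parity and the inert leaf — corank `1` being certified by seat
c301 on each residue class (`selmerCorank_two_eq_one_twoSplitThreeTwist` gen 3 part XX, `…_twoSplitFiveTwist` gen 2,
`…_twoSplitSevenTwist` gen 3 part XVIII). Numerically `r_an = 1` for every such `ℓ` of kit j264668; for split
`ℓ ≡ 1 (mod 8)` analytic rank `3` OCCURS (`49a1^{(−2·1481)}`, `49a1^{(−2·2417)}`), so no hypothesis-free form exists there.
[cite: DokchitserDokchitserAnnals2010, Thm. 1.4] [cite: CoatesLiTianZhai2015, Thm. 1.2 (p. 359, case r = 0)] -/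
theorem analyticRank_eq_one_twoSplitPrimeTwist_neOneModEight_of_inertSeven (hnf : ModularForms.exists_isNewformOf)
    (h12 : CoatesLiTianZhai2015.thm12_fullBSD_twist) (hpar : ∀ (V : WeierstrassCurve ℚ) [V.IsElliptic], p_parity V 2)
    (hI : X049KLevelTwoConverseInertSeven) {l : ℕ} [Fact l.Prime] (hl2 : l ≠ 2) (hl8 : l % 8 ≠ 1)
    (hl7 : legendreSym l (-7) = 1) (W : WeierstrassCurve ℚ) [W.IsElliptic] (C : VariableChange ℚ)
    (hC : C • W = cm7.quadraticTwist ((-2 * l : ℤ) : ℚ)) : W.analyticRank = 1 := by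
  have hl : l.Prime := Fact.out
  have hj : jacobiSym l 7 = 1 := jacobiSym_seven_eq_one_of_legendreSym_neg_seven hl2 hl7
  have hC' : C • W = cm7.quadraticTwist ((-(2 * l) : ℤ) : ℚ) := by rw [hC]; push_cast; ring_nf
  have hodd : l % 2 = 1 := Nat.odd_iff.mp (hl.odd_of_ne_two hl2)
  have hsel : W.selmerCorank 2 = 1 := by
    rcases (show l % 8 = 3 ∨ l % 8 = 5 ∨ l % 8 = 7 by omega) with h | h | h
    · exact selmerCorank_two_eq_one_twoSplitThreeTwist hnf h12 hpar h hl7 W C hC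
    · exact selmerCorank_two_eq_one_twoSplitFiveTwist hnf h12 hpar h hl7 W C hC
    · exact selmerCorank_two_eq_one_twoSplitSevenTwist hnf h12 hpar h hl7 W C hC
  exact analyticRank_eq_one_twoSplitPrimeTwist_of_inertSeven (hasEntireLFunction_rat_of_exists_isNewformOf hnf) h12
    hI hl hl2 hj W C hC' hsel

/-- **K12₂″ ITSELF asserts «D_split(ℓ)»** (honesty, no leaf): granted Modularity, Coates–Li–Tian–Zhai 1.2 at `R = 1`
and `2`-parity, the crux (route decl, by name) gives `ord_{s=1} L(W, s) = 1` for every globally minimal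
`W ≅_ℚ 49a1^{(−ℓ)}`, `ℓ ≡ 5 (mod 8)` prime split in `ℚ(√−7)` — its corank hypothesis being a theorem there
(`selmerCorank_two_eq_one_splitPrimeTwist`) and the twist negative with `7 ∤ ℓ` (c301's
`negTwists_of_rankOneTwoConverseCMSevenAdditiveTwo`). So «D_split» is a NECESSARY content of item 20044 on the
`7`-inert half, exactly as «D(q)» is on the Heegner half. [cite: DokchitserDokchitserAnnals2010, Thm. 1.4]
[cite: BurungaleCastellaSkinnerTian2022, Rem. D] -/
theorem analyticRank_eq_one_splitPrimeTwist_of_rankOneTwoConverseCMSevenAdditiveTwo (hnf : ModularForms.exists_isNewformOf)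
    (h12 : CoatesLiTianZhai2015.thm12_fullBSD_twist) (hpar : ∀ (V : WeierstrassCurve ℚ) [V.IsElliptic], p_parity V 2)
    (hK : Summit.BirchSwinnertonDyer.BirchSwinnertonDyer.Theses.GoldfeldAllTwistsTwoConverse.RankOneTwoConverseCMSevenAdditiveTwo)
    {l : ℕ} [Fact l.Prime] (hl8 : l % 8 = 5) (hl7 : legendreSym l (-7) = 1)
    (W : WeierstrassCurve ℚ) [W.IsElliptic] [W.IsGloballyMinimal] (C : VariableChange ℚ)
    (hC : C • W = cm7.quadraticTwist ((-l : ℤ) : ℚ)) : W.analyticRank = 1 := by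
  have hl : l.Prime := Fact.out
  have hsq : Squarefree (-(l : ℤ)) := by
    rw [← Int.squarefree_natAbs, Int.natAbs_neg, Int.natAbs_natCast]
    exact hl.squarefree
  have h7 : ¬ (7 : ℤ) ∣ -(l : ℤ) := by
    intro h
    have h7l : (7 : ℕ) ∣ l := by exact_mod_cast (dvd_neg.mp h)
    have : l = 7 := ((Nat.prime_dvd_prime_iff_eq (by norm_num) hl).mp h7l).symm
    subst this
    norm_num at hl8
  have hd : -(l : ℤ) < 0 := by have := hl.pos; omega
  exact negTwists_of_rankOneTwoConverseCMSevenAdditiveTwo hK (-l) hd hsq h7 (by omega) W C hC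
    (selmerCorank_two_eq_one_splitPrimeTwist hnf h12 hpar hl8 hl7 W C hC)

end Summit.BirchSwinnertonDyer.BirchSwinnertonDyer.Theorems.GoldfeldGoodTwists

end
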